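import Literature.AnabelianGeometry.SemiGraphs.ProSigmaCompletionModels
import Literature.AnabelianGeometry.SemiGraphs.ProSigmaCompletionTFG
import Literature.AnabelianGeometry.SemiGraphs.ProSigmaCompletionInjective
import Literature.AnabelianGeometry.SemiGraphs.ProSigmaPuncturedSurfaceElastic
import Literature.AnabelianGeometry.AbsoluteAnabelian.FreeProSigmaCompletionBridge
import Literature.GroupTheory.ProPPowerMap
import HarnessLib

/-!
# The free pro-`p` group of rank two `F̂₂⁽ᵖ⁾` as a concrete profinite group

Classical object (Ribes–Zalesskii, *Profinite Groups*, §3.3 "free pro-`𝒞` groups"; Serre, *Galois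
Cohomology* I §1.5): the pro-`p` completion of the free group `F₂ = F(x₀, x₁)`, i.e. the free pro-`p`
group on two generators `a = x̂₀`, `b = x̂₁`, together with its continuous abelianisation
`F̂₂⁽ᵖ⁾ → ℤ_p × ℤ_p` (`a ↦ (1,0)`, `b ↦ (0,1)`).

Everything is DERIVED from the tree's interface `SemiGraphOfAnabelioids.IsProSigmaCompletion`
([SemiAnbd] Example 2.10) at `Σ = {p}`, `Γ = FreeGroup (Fin 2)`: the group is the completion provided by
`IsProSigmaCompletion.exists_isProSigmaCompletion` (chosen once, `Grp p`), and slimness, topological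
finite generation, injectivity of `F₂ → F̂₂⁽ᵖ⁾`, the universal property (`IsFreeProOn`) are the tree's
theorems instantiated.  No notion is re-defined.

Purpose (abc-iut cell, L3 FRONTIER programme «REFUTE-F1732», brick R1 "THE GROUP"): the vertex group of
the semi-graph of anabelioids `𝒢_θ` (desk countermodel of abc-iut-L3-d1 to the ∀-countable reading of
[SemiAnbd] Thm 3.7 (iii); print proves the finite-semi-graph case, kernel `p431007`).  Honest framing:
classical group theory only; nothing here bears on [IUTchIII] Cor. 3.12; typed ≠ proved elsewhere.
-/

noncomputable section

open Topology Filter Multiplicative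
open Literature.AnabelianGeometry.SemiGraphs.SemiGraphOfAnabelioids (IsProSigmaCompletion)
open Literature.AnabelianGeometry.SemiGraphs.SemiGraphOfAnabelioids.IsProSigmaCompletion
open Literature.AnabelianGeometry.Anabelioids (IsSigmaInteger)
open Literature.AnabelianGeometry.AbsoluteAnabelian
open Literature.AlgebraicGeometry.Frobenioids (IsSlimGroup)

namespace Literature.AnabelianGeometry.SemiGraphs.FreeProPRankTwo

variable (p : ℕ)

/-! ### The group, the completion map and the two generators -/

/-- `F̂₂⁽ᵖ⁾`, the free pro-`p` group of rank two: the pro-`{p}` completion of `FreeGroup (Fin 2)`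
provided by `IsProSigmaCompletion.exists_isProSigmaCompletion`, as a `ProfiniteGrp` (use `↥(Grp p)`).
[cite: RibesZalesskii2010, §3.3] -/
def Grp : ProfiniteGrp.{0} :=
  (exists_isProSigmaCompletion (FreeGroup (Fin 2)) ({p} : Set ℕ)).choose

/-- The completion map `ι : F₂ → F̂₂⁽ᵖ⁾`. [cite: RibesZalesskii2010, §3.3] -/
def ι : FreeGroup (Fin 2) →* Grp p :=
  (exists_isProSigmaCompletion (FreeGroup (Fin 2)) ({p} : Set ℕ)).choose_spec.choose

/-- `ι : F₂ → F̂₂⁽ᵖ⁾` is a pro-`{p}` completion in the sense of [SemiAnbd] Example 2.10.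
[cite: MochizukiSemiAnbd2006, Ex. 2.10 p.31] -/
theorem isProSigmaCompletion_ι : IsProSigmaCompletion ({p} : Set ℕ) (ι p) :=
  (exists_isProSigmaCompletion (FreeGroup (Fin 2)) ({p} : Set ℕ)).choose_spec.choose_spec

/-- The first topological generator `a = ι(x₀)`. [cite: RibesZalesskii2010, §3.3] -/
def a : Grp p := ι p (FreeGroup.of 0)

/-- The second topological generator `b = ι(x₁)`. [cite: RibesZalesskii2010, §3.3] -/
def b : Grp p := ι p (FreeGroup.of 1)

/-- `a` is the image of the standard basis vector `x₀` (the shape consumed by the tree's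
`ProSigmaCompletionMalnormal` / `…Slim` engines with `FreeGroupBasis.ofFreeGroup`). [cite: RibesZalesskii2010, §3.3] -/
theorem ι_ofFreeGroup_zero : ι p (FreeGroupBasis.ofFreeGroup (Fin 2) 0) = a p := rfl

/-- `b` is the image of the standard basis vector `x₁`. [cite: RibesZalesskii2010, §3.3] -/
theorem ι_ofFreeGroup_one : ι p (FreeGroupBasis.ofFreeGroup (Fin 2) 1) = b p := rfl

/-- The generating pair as a family `Fin 2 → F̂₂⁽ᵖ⁾`. [cite: RibesZalesskii2010, §3.3] -/
def gens : Fin 2 → Grp p := ![a p, b p]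

/-- `gens 0 = a`. [cite: RibesZalesskii2010, §3.3] -/
@[simp] theorem gens_zero : gens p 0 = a p := rfl

/-- `gens 1 = b`. [cite: RibesZalesskii2010, §3.3] -/
@[simp] theorem gens_one : gens p 1 = b p := rfl

/-- `FreeGroup.lift gens` is the completion map `ι`. [cite: RibesZalesskii2010, §3.3] -/
theorem lift_gens_eq_ι : FreeGroup.lift (gens p) = ι p := by
  refine FreeGroup.ext_hom _ _ fun i => ?_
  rw [FreeGroup.lift_apply_of]
  fin_cases i <;> rfl

/-- `FreeGroup.lift gens : F₂ → F̂₂⁽ᵖ⁾` is a pro-`{p}` completion. [cite: MochizukiSemiAnbd2006, Ex. 2.10 p.31] -/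
theorem isProSigmaCompletion_lift_gens :
    IsProSigmaCompletion ({p} : Set ℕ) (FreeGroup.lift (gens p)) := by
  rw [lift_gens_eq_ι]
  exact isProSigmaCompletion_ι p

/-- `F̂₂⁽ᵖ⁾` is free pro-`{p}` on `(a, b)` in the sense of [AbsTopI] Lemma 4.5 (i) (universal property
for finite `p`-groups). [cite: MochizukiAbsTopI2012, Lemma 4.5 (i) p.54] -/
theorem isFreeProOn : IsFreeProOn (Grp p) ({p} : Set ℕ) (gens p) :=
  isFreeProOn_of_isProSigmaCompletion_lift (isProSigmaCompletion_lift_gens p)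

section Prime

variable [hp : Fact p.Prime]

/-- `F₂ → F̂₂⁽ᵖ⁾` is injective (free groups are residually `p`). [cite: RibesZalesskii2010, §3.3] -/
theorem ι_injective : Function.Injective (ι p) :=
  injective_of_isFreeGroup (isProSigmaCompletion_ι p) ⟨p, rfl, hp.out⟩

/-- `a ≠ 1`. [cite: RibesZalesskii2010, §3.3] -/
theorem a_ne_one : a p ≠ 1 := fun h =>
  FreeGroup.of_ne_one (0 : Fin 2) (ι_injective p (h.trans (map_one (ι p)).symm))

/-- `b ≠ 1`. [cite: RibesZalesskii2010, §3.3] -/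
theorem b_ne_one : b p ≠ 1 := fun h =>
  FreeGroup.of_ne_one (1 : Fin 2) (ι_injective p (h.trans (map_one (ι p)).symm))

/-- `a ≠ b`. [cite: RibesZalesskii2010, §3.3] -/
theorem a_ne_b : a p ≠ b p := fun h =>
  absurd (FreeGroup.of_injective (ι_injective p h)) (by decide)

/-- `a` and `b` do not commute. [cite: RibesZalesskii2010, §3.3] -/
theorem a_mul_b_ne_b_mul_a : a p * b p ≠ b p * a p := by
  intro h
  have h' : ι p (FreeGroup.of 0 * FreeGroup.of 1) = ι p (FreeGroup.of 1 * FreeGroup.of 0) := by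
    rw [map_mul, map_mul]
    exact h
  have := ι_injective p h'
  -- two distinct free generators do not commute (seen in `S₃`)
  let f : Fin 2 → Equiv.Perm (Fin 3) := ![Equiv.swap 0 1, Equiv.swap 1 2]
  have h'' := congrArg (FreeGroup.lift f) this
  simp only [map_mul, FreeGroup.lift_apply_of] at h''
  exact absurd h'' (by decide)

end Prime

/-! ### Topological generation -/

/-- The image of `F₂` is dense in `F̂₂⁽ᵖ⁾`. [cite: RibesZalesskii2010, §3.3] -/
theorem denseRange_ι : DenseRange (ι p) := (isProSigmaCompletion_ι p).dense

/-- `a, b` generate a dense subgroup: `closure {a, b}` has full topological closure.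
[cite: RibesZalesskii2010, §3.3] -/
theorem topologicalClosure_closure_pair :
    (Subgroup.closure ({a p, b p} : Set (Grp p))).topologicalClosure = ⊤ := by
  have hcl : Subgroup.closure ({a p, b p} : Set (Grp p)) = (ι p).range := by
    have hs : ({a p, b p} : Set (Grp p)) = ι p '' Set.range (FreeGroup.of : Fin 2 → FreeGroup (Fin 2)) := by
      ext x
      simp only [Set.mem_insert_iff, Set.mem_singleton_iff, Set.mem_image, Set.mem_range,
        exists_exists_eq_and]
      constructor
      · rintro (rfl | rfl)
        exacts [⟨0, rfl⟩, ⟨1, rfl⟩]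
      · rintro ⟨i, rfl⟩
        fin_cases i
        exacts [Or.inl rfl, Or.inr rfl]
    rw [hs, ← MonoidHom.map_closure, FreeGroup.closure_range_of, ← MonoidHom.range_eq_map]
  apply SetLike.coe_injective
  rw [Subgroup.topologicalClosure_coe, hcl, Subgroup.coe_top, MonoidHom.coe_range]
  exact (denseRange_ι p).closure_range

/-- A generating `Finset` of cardinality `≤ 2` (the shape of `IsStrictlyCoherent.exists_bound`).
[cite: RibesZalesskii2010, §3.3] -/
theorem exists_generating_finset :
    ∃ s : Finset (Grp p), s.card ≤ 2 ∧
      (Subgroup.closure (s : Set (Grp p))).topologicalClosure = ⊤ := by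
  classical
  refine ⟨{a p, b p}, Finset.card_le_two, ?_⟩
  rw [Finset.coe_insert, Finset.coe_singleton]
  exact topologicalClosure_closure_pair p

/-- `F̂₂⁽ᵖ⁾` is topologically finitely generated. [cite: MochizukiAbsTopI2012, Prop 2.2 p.18] -/
theorem isTopologicallyFinitelyGenerated : IsTopologicallyFinitelyGenerated (Grp p) :=
  (isFreeProOn p).isTopologicallyFinitelyGenerated

/-! ### `F̂₂⁽ᵖ⁾` is pro-`p` -/

/-- Open normal subgroups of `F̂₂⁽ᵖ⁾` have `{p}`-integer index. [cite: RibesZalesskii2010, §3.3] -/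
theorem isSigmaInteger_index (U : Subgroup (Grp p)) [hU : U.Normal] (hUo : IsOpen (U : Set (Grp p))) :
    IsSigmaInteger ({p} : Set ℕ) U.index :=
  (isProSigmaCompletion_ι p).index_open U hU hUo

/-- Open normal subgroups of `F̂₂⁽ᵖ⁾` have `p`-power index. [cite: RibesZalesskii2010, §3.3] -/
theorem exists_index_eq_prime_pow (U : Subgroup (Grp p)) [U.Normal] (hUo : IsOpen (U : Set (Grp p))) :
    ∃ k : ℕ, U.index = p ^ k := by
  obtain ⟨hpos, hprimes⟩ := isSigmaInteger_index p U hUo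
  exact ⟨_, Nat.eq_prime_pow_of_unique_prime_dvd hpos.ne' fun {q} hq hqd => hprimes q hq hqd⟩

/-- `F̂₂⁽ᵖ⁾` is pro-`p` in the phrasing of `Literature.GroupTheory.ProPPowerMap`: every quotient by an
open normal subgroup is a `p`-group. [cite: SerreGaloisCohomology1997, I §1.5] -/
theorem isPGroup_quotient (U : OpenNormalSubgroup (Grp p)) :
    IsPGroup p (Grp p ⧸ (U : Subgroup (Grp p))) := by
  haveI : (U : Subgroup (Grp p)).Normal := U.isNormal'
  obtain ⟨k, hk⟩ := exists_index_eq_prime_pow p (U : Subgroup (Grp p)) U.isOpen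
  haveI : Finite (Grp p ⧸ (U : Subgroup (Grp p))) :=
    Subgroup.quotient_finite_of_isOpen _ U.isOpen
  exact IsPGroup.of_card (by rw [← Subgroup.index_eq_card, hk])

/-- Every open subgroup of `F̂₂⁽ᵖ⁾` contains some power `g ^ p ^ k` of every element.
[cite: SerreGaloisCohomology1997, I §1.5] -/
theorem exists_pow_prime_pow_mem (U : Subgroup (Grp p)) (hUo : IsOpen (U : Set (Grp p))) (g : Grp p) :
    ∃ k : ℕ, g ^ p ^ k ∈ U :=
  Literature.GroupTheory.forall_nhds_pow_mem_of_isPGroup_quotient (isPGroup_quotient p) g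
    (hUo.mem_nhds U.one_mem)

/-- In `F̂₂⁽ᵖ⁾` the powers `g ^ p ^ k` tend to `1`. [cite: SerreGaloisCohomology1997, I §1.5] -/
theorem tendsto_pow_prime_pow (g : Grp p) : Tendsto (fun k : ℕ => g ^ p ^ k) atTop (𝓝 1) := by
  rw [tendsto_atTop_nhds]
  intro U h1 hUo
  obtain ⟨N, hN⟩ := ProfiniteGrp.exist_openNormalSubgroup_sub_open_nhds_of_one hUo h1
  obtain ⟨k, hk⟩ := exists_pow_prime_pow_mem p (N : Subgroup (Grp p)) N.isOpen g
  refine ⟨k, fun n hn => hN ?_⟩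
  obtain ⟨j, rfl⟩ := Nat.exists_eq_add_of_le hn
  change g ^ p ^ (k + j) ∈ (N : Subgroup (Grp p))
  rw [pow_add, pow_mul]
  exact Subgroup.pow_mem _ hk _

/-! ### Slimness -/

/-- **`F̂₂⁽ᵖ⁾` is slim**: every open subgroup has trivial centraliser ([AbsAnab] Lemma 1.3.1, affine
case; the tree's `IsProSigmaCompletion.isSlimGroup`). [cite: MochizukiAbsAnab2004, Lemma 1.3.1 p.15] -/
theorem isSlimGroup : IsSlimGroup (Grp p) :=
  (isFreeProOn p).isSlimGroup le_rfl

/-- `F̂₂⁽ᵖ⁾` has trivial centre. [cite: MochizukiAbsAnab2004, Lemma 1.3.1 p.15] -/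
theorem center_eq_bot : Subgroup.center (Grp p) = ⊥ := by
  have h := (isSlimGroup p).centralizer_eq_bot ⊤ isOpen_univ
  rw [eq_bot_iff] at h ⊢
  intro z hz
  exact h (Subgroup.mem_centralizer_iff.mpr fun y _ => (Subgroup.mem_center_iff.mp hz) y)

/-! ### The continuous abelianisation `F̂₂⁽ᵖ⁾ → ℤ_p × ℤ_p` -/

section Prime2

variable [hp : Fact p.Prime]

/-- Open subgroups of `ℤ_p × ℤ_p` have `{p}`-integer index (`pⁿ • x → 0`).
[cite: SerreGaloisCohomology1997, I §1.5] -/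
theorem isSigmaInteger_index_padicProd (V : Subgroup (Multiplicative (ℤ_[p] × ℤ_[p])))
    (hV : IsOpen (V : Set (Multiplicative (ℤ_[p] × ℤ_[p])))) :
    IsSigmaInteger ({p} : Set ℕ) V.index := by
  classical
  haveI : Finite (Multiplicative (ℤ_[p] × ℤ_[p]) ⧸ V) := Subgroup.quotient_finite_of_isOpen V hV
  have hP : IsPGroup p (Multiplicative (ℤ_[p] × ℤ_[p]) ⧸ V) := by
    intro q
    obtain ⟨x, rfl⟩ := QuotientGroup.mk_surjective q
    have h0 : Tendsto (fun n : ℕ => ((p : ℤ_[p]) ^ n)) atTop (𝓝 0) :=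
      tendsto_pow_atTop_nhds_zero_of_norm_lt_one (by
        rw [PadicInt.norm_p]
        exact inv_lt_one_of_one_lt₀ (by exact_mod_cast hp.out.one_lt))
    have h1 : Tendsto (fun n : ℕ => ((p : ℤ_[p]) ^ n) • x.toAdd) atTop (𝓝 0) := by
      simpa using h0.smul_const x.toAdd
    have ht : Tendsto (fun n : ℕ => ofAdd (((p : ℤ_[p]) ^ n) • x.toAdd)) atTop (𝓝 1) :=
      (continuous_ofAdd.tendsto _).comp h1
    have hmem : ∀ᶠ n : ℕ in atTop, ofAdd (((p : ℤ_[p]) ^ n) • x.toAdd) ∈ V :=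
      ht (hV.mem_nhds V.one_mem)
    obtain ⟨n, hn⟩ := hmem.exists
    refine ⟨n, ?_⟩
    rw [← QuotientGroup.mk_pow, QuotientGroup.eq_one_iff]
    have hx : ofAdd (((p : ℤ_[p]) ^ n) • x.toAdd) = x ^ p ^ n := by
      rw [← Nat.cast_pow, Nat.cast_smul_eq_nsmul, ofAdd_nsmul, ofAdd_toAdd]
    rwa [← hx]
  obtain ⟨n, hn⟩ := IsPGroup.iff_card.mp hP
  rw [Subgroup.index_eq_card, hn]
  exact ⟨pow_pos hp.out.pos n, fun q hq hqd => (Nat.prime_dvd_prime_iff_eq hq hp.out).mp (hq.dvd_of_dvd_pow hqd)⟩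

/-- The abelianisation on the dense free subgroup: `x₀ ↦ (1,0)`, `x₁ ↦ (0,1)`. [cite: RibesZalesskii2010, §3.3] -/
def abLift : FreeGroup (Fin 2) →* Multiplicative (ℤ_[p] × ℤ_[p]) :=
  FreeGroup.lift ![ofAdd (1, 0), ofAdd (0, 1)]

/-- `abLift x₀ = (1,0)`. [cite: RibesZalesskii2010, §3.3] -/
@[simp] theorem abLift_of_zero : abLift p (FreeGroup.of 0) = ofAdd (1, 0) := by
  simp [abLift, FreeGroup.lift_apply_of]

/-- `abLift x₁ = (0,1)`. [cite: RibesZalesskii2010, §3.3] -/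
@[simp] theorem abLift_of_one : abLift p (FreeGroup.of 1) = ofAdd (0, 1) := by
  simp [abLift, FreeGroup.lift_apply_of]

/-- Existence of the continuous extension of `abLift` to `F̂₂⁽ᵖ⁾` (universal property of the pro-`p`
completion towards the pro-`p` group `ℤ_p × ℤ_p`). [cite: RibesZalesskii2010, §3.3] -/
theorem exists_ab : ∃ F : Grp p →* Multiplicative (ℤ_[p] × ℤ_[p]),
    Continuous F ∧ ∀ γ, F (ι p γ) = abLift p γ :=
  exists_continuous_extend_profinite (isProSigmaCompletion_ι p)
    (fun V _ hVo => isSigmaInteger_index_padicProd p V hVo) (abLift p)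

/-- **The continuous abelianisation** `ab : F̂₂⁽ᵖ⁾ → ℤ_p × ℤ_p`, `a ↦ (1,0)`, `b ↦ (0,1)`
(written multiplicatively). [cite: RibesZalesskii2010, §3.3] -/
def ab : Grp p →ₜ* Multiplicative (ℤ_[p] × ℤ_[p]) where
  toMonoidHom := (exists_ab p).choose
  continuous_toFun := (exists_ab p).choose_spec.1

/-- `ab` extends `abLift` along `ι`. [cite: RibesZalesskii2010, §3.3] -/
theorem ab_ι (γ : FreeGroup (Fin 2)) : ab p (ι p γ) = abLift p γ :=
  (exists_ab p).choose_spec.2 γ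

/-- `ab a = (1, 0)`. [cite: RibesZalesskii2010, §3.3] -/
@[simp] theorem ab_a : ab p (a p) = ofAdd (1, 0) := by
  rw [a, ab_ι, abLift_of_zero]

/-- `ab b = (0, 1)`. [cite: RibesZalesskii2010, §3.3] -/
@[simp] theorem ab_b : ab p (b p) = ofAdd (0, 1) := by
  rw [b, ab_ι, abLift_of_one]

omit hp in
/-- Uniqueness: a continuous homomorphism `F̂₂⁽ᵖ⁾ → ℤ_p × ℤ_p` is determined by its values on `a`, `b`
(more generally into any Hausdorff group). [cite: RibesZalesskii2010, §3.3] -/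
theorem continuousMonoidHom_ext {M : Type*} [Monoid M] [TopologicalSpace M] [T2Space M]
    {F F' : Grp p →ₜ* M} (ha : F (a p) = F' (a p)) (hb : F (b p) = F' (b p)) : F = F' := by
  have hcomp : F.toMonoidHom.comp (ι p) = F'.toMonoidHom.comp (ι p) :=
    FreeGroup.ext_hom _ _ fun i => by
      fin_cases i
      · exact ha
      · exact hb
  have key : (F : Grp p → M) = F' :=
    Continuous.ext_on (denseRange_ι p) F.continuous F'.continuous (by
      rintro _ ⟨γ, rfl⟩
      exact DFunLike.congr_fun hcomp γ)
  exact ContinuousMonoidHom.ext fun x => congrFun key x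

/-- The first coordinate character `χ_a : F̂₂⁽ᵖ⁾ → ℤ_p` (`a ↦ 1`, `b ↦ 0`). [cite: RibesZalesskii2010, §3.3] -/
def χa : Grp p →ₜ* Multiplicative ℤ_[p] where
  toFun x := ofAdd (ab p x).toAdd.1
  map_one' := by simp
  map_mul' x y := by simp [ofAdd_add]
  continuous_toFun :=
    continuous_ofAdd.comp (continuous_fst.comp (continuous_toAdd.comp (ab p).continuous))

/-- The second coordinate character `χ_b : F̂₂⁽ᵖ⁾ → ℤ_p` (`a ↦ 0`, `b ↦ 1`). [cite: RibesZalesskii2010, §3.3] -/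
def χb : Grp p →ₜ* Multiplicative ℤ_[p] where
  toFun x := ofAdd (ab p x).toAdd.2
  map_one' := by simp
  map_mul' x y := by simp [ofAdd_add]
  continuous_toFun :=
    continuous_ofAdd.comp (continuous_snd.comp (continuous_toAdd.comp (ab p).continuous))

/-- `χ_a` is the first coordinate of `ab`. [cite: RibesZalesskii2010, §3.3] -/
theorem χa_apply (x : Grp p) : χa p x = ofAdd (ab p x).toAdd.1 := rfl

/-- `χ_b` is the second coordinate of `ab`. [cite: RibesZalesskii2010, §3.3] -/
theorem χb_apply (x : Grp p) : χb p x = ofAdd (ab p x).toAdd.2 := rfl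

/-- `χ_a(a) = 1`. [cite: RibesZalesskii2010, §3.3] -/
@[simp] theorem χa_a : χa p (a p) = ofAdd 1 := by simp [χa_apply]

/-- `χ_a(b) = 0`. [cite: RibesZalesskii2010, §3.3] -/
@[simp] theorem χa_b : χa p (b p) = 1 := by simp [χa_apply]

/-- `χ_b(a) = 0`. [cite: RibesZalesskii2010, §3.3] -/
@[simp] theorem χb_a : χb p (a p) = 1 := by simp [χb_apply]

/-- `χ_b(b) = 1`. [cite: RibesZalesskii2010, §3.3] -/
@[simp] theorem χb_b : χb p (b p) = ofAdd 1 := by simp [χb_apply]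

/-- `ab` is the pair `(χ_a, χ_b)`. [cite: RibesZalesskii2010, §3.3] -/
theorem ab_eq (x : Grp p) : ab p x = ofAdd ((χa p x).toAdd, (χb p x).toAdd) := by
  simp [χa_apply, χb_apply]

end Prime2

end Literature.AnabelianGeometry.SemiGraphs.FreeProPRankTwo

end
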